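import Literature.AlgebraicGeometry.Resolution.PowerSeriesRegularLocal
import Mathlib.RingTheory.MvPowerSeries.Order
import Mathlib.RingTheory.MvPowerSeries.Inverse
import Mathlib.FieldTheory.IsAlgClosed.Basic
import Mathlib.LinearAlgebra.Dimension.Finrank
import Mathlib.RingTheory.Finiteness.Defs
import Mathlib.RingTheory.Ideal.Quotient.Operations
import HarnessLib

/-!
# Finite determinacy of isolated hypersurface singularities in arbitrary characteristic
# (Boubakri–Greuel–Markwig, Thm. 2.1 / Cor. 2.4)

Topic: `Literature/AlgebraicGeometry/Resolution` (singularity theory in characteristic `p`, used by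
the summit `ResolutionOfSingularities`). Source: Y. Boubakri, G.-M. Greuel, T. Markwig,
*Invariants of hypersurface singularities in positive characteristic*, Rev. Mat. Complut. 25
(2012) 61–85 = arXiv:1005.4503 [BoubakriGreuelMarkwig2010]; theorem numbers below are those of the
arXiv text (read: pp. 3–7 of the materialised copy, §1 definitions and §2 "Finite determinacy").

Standing conventions of the paper (§1, p. 3): `K` is an ALGEBRAICALLY CLOSED field of arbitrary
characteristic, `K[[x]] = K[[x₁,…,xₙ]]` with `n ≥ 2`, `𝔪` its maximal ideal; `Aut(K[[x]])` acts by
substitution (the automorphisms built in the proof of Thm. 2.1 are `xᵢ ↦ xᵢ + bᵢ`), rendered here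
as `K`-algebra automorphisms `K[[x]] ≃ₐ[K] K[[x]]`.

## Content (definitions with body + two NAMED FACTS, no `sorry`)

* `jacobianIdeal f = ⟨∂f/∂x₁, …, ∂f/∂xₙ⟩`, `tjurinaIdeal f = ⟨f⟩ + j(f)` (§1 p. 3), with the
  tree's formal partial derivative `MvPowerSeries.pderiv` (`PowerSeriesRegularLocal.lean`);
  `milnorNumber f = dim_K K[[x]]/j(f)`, `tjurinaNumber f = dim_K K[[x]]/tj(f)` (as `Module.finrank`,
  i.e. `0` when infinite — always read together with the finiteness predicates);
  `IsIsolated f :⇔ μ(f) < ∞` ("we simply call `f` an isolated singularity if `μ(f) < ∞`") and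
  `IsIsolatedHypersurface f :⇔ τ(f) < ∞`, both as `Module.Finite K` of the quotient.
* `RightEquivalent f g :⇔ ∃ φ ∈ Aut_K K[[x]], f = φ g`; `ContactEquivalent f g :⇔ ∃ φ, ∃ unit u,
  f = u · φ g` (§1 p. 3).
* `HaveSameJet k f g :⇔ f − g ∈ 𝔪^{k+1}` (equal `k`-jets), `IsRightDetermined k f`,
  `IsContactDetermined k f` (§1 p. 4: "`f` is right `k`-determined if `f` is right equivalent to
  every `g` whose `k`-jet coincides with that of `f`").
* `ord f` — the order of `f` ("the largest `k` with `f ∈ 𝔪ᵏ`", §2 p. 6), rendered as Mathlib's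
  total-degree order `(MvPowerSeries.order f).toNat` (the two agree on `K[[x₁,…,xₙ]]`, `n` finite,
  for `f ≠ 0`).
* **`Thm21`** — Theorem 2.1: for `0 ≠ f ∈ 𝔪²` and `k ∈ ℕ`, (1) `𝔪^{k+2} ⊆ 𝔪²·j(f)` ⇒ `f` is right
  `(2k − ord f + 2)`-determined; (2) `𝔪^{k+2} ⊆ 𝔪·⟨f⟩ + 𝔪²·j(f)` ⇒ `f` is contact
  `(2k − ord f + 2)`-determined.
* **`Cor24`** — Corollary 2.4: for `0 ≠ f ∈ 𝔪²`, (1) `μ(f) < ∞` ⇒ right determinacy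
  `≤ 2μ(f) − ord f + 2`; (2) `τ(f) < ∞` ⇒ contact determinacy `≤ 2τ(f) − ord f + 2`.

On the `ℕ`-subtraction in the bounds: under the hypothesis of Thm. 2.1 the first line of the
printed proof gives `k ≥ ord f − 1`, i.e. `ord f ≤ k + 1 ≤ 2k + 2` (and `ord f ≤ μ(f) + 1`,
`≤ τ(f) + 1` in Cor. 2.4 via Remark 2.3(c): `𝔪^{μ(f)} ⊆ j(f)`), so `2 * k + 2 - ord f` is the
printed integer `2k − ord(f) + 2 ≥ k + 1`, never a truncated difference.

Grounding note (grounder, route `ResolutionOfSingularities/FrobeniusClosing`): these facts are the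
"finite determinacy" input (i) of the proof plan of
`Summit.ResolutionOfSingularities.ResolutionOfSingularities.Theses.FrobeniusClosing.ClosingReduction`
(bounded Milnor number ⇒ the chain lives in one finite jet space); the route's `Isol c` is literally
`IsIsolated (ser c)` up to unfolding `jacobianIdeal`/`MvPowerSeries.pderiv` (same coefficient
formula `(Aᵢ+1)·f(A+eᵢ)`), and its pair-isomorphism group contains right equivalence. The printed
proof of Thm. 2.1 uses neither algebraic closedness of `K` nor `n ≥ 2` (it is an `𝔪`-adic
successive-substitution argument valid over any field); both are kept here because they are the
paper's standing hypotheses — a literature-prover discharging the facts may prove the general form.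

## Not vendored

* Thm. 2.5/2.7 (finite determinacy ⇒ isolated; the equivalence "Theorem (fd = isolated)"), §3
  non-degeneracy (Kouchnirenko, Wall, Beelen–Pellikaan) and §4 Milnor's formula `μ = 2δ − r + 1` for
  planar Newton non-degenerate singularities — not requested by any route yet.
-/

noncomputable section

namespace Literature.AlgebraicGeometry.Resolution

namespace BoubakriGreuelMarkwig

open IsLocalRing

variable {K : Type*} [Field K] {n : ℕ}

/-- The **Jacobian ideal** `j(f) = ⟨f_{x₁}, …, f_{xₙ}⟩ ⊆ K[[x₁,…,xₙ]]` generated by the formal partial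
derivatives of `f`. [cite: BoubakriGreuelMarkwig2010, §1 (p. 3)] -/
def jacobianIdeal (f : MvPowerSeries (Fin n) K) : Ideal (MvPowerSeries (Fin n) K) :=
  Ideal.span (Set.range fun i : Fin n => MvPowerSeries.pderiv i f)

/-- The **Tjurina ideal** `tj(f) = ⟨f, f_{x₁}, …, f_{xₙ}⟩ = ⟨f⟩ + j(f)`.
[cite: BoubakriGreuelMarkwig2010, §1 (p. 3)] -/
def tjurinaIdeal (f : MvPowerSeries (Fin n) K) : Ideal (MvPowerSeries (Fin n) K) :=
  Ideal.span {f} ⊔ jacobianIdeal f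

/-- The **Milnor number** `μ(f) = dim_K M_f`, `M_f = K[[x]]/j(f)` the Milnor algebra — as a natural
number (`Module.finrank`, hence `0` when `M_f` is infinite-dimensional: only meaningful together with
`IsIsolated f`). [cite: BoubakriGreuelMarkwig2010, §1 (p. 3)] -/
def milnorNumber (f : MvPowerSeries (Fin n) K) : ℕ :=
  Module.finrank K (MvPowerSeries (Fin n) K ⧸ jacobianIdeal f)

/-- The **Tjurina number** `τ(f) = dim_K T_f`, `T_f = K[[x]]/tj(f)` (as `Module.finrank`; see
`milnorNumber`). [cite: BoubakriGreuelMarkwig2010, §1 (p. 3)] -/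
def tjurinaNumber (f : MvPowerSeries (Fin n) K) : ℕ :=
  Module.finrank K (MvPowerSeries (Fin n) K ⧸ tjurinaIdeal f)

/-- `f` is an **isolated singularity**: `μ(f) < ∞`, i.e. the Milnor algebra `K[[x]]/j(f)` is a
finite-dimensional `K`-vector space ("equivalent to the existence of a positive integer `k` such that
`𝔪ᵏ ⊆ j(f)`"). [cite: BoubakriGreuelMarkwig2010, §1 (p. 3)] -/
def IsIsolated (f : MvPowerSeries (Fin n) K) : Prop :=
  Module.Finite K (MvPowerSeries (Fin n) K ⧸ jacobianIdeal f)

/-- `R_f = K[[x]]/⟨f⟩` is an **isolated hypersurface singularity**: `τ(f) < ∞`, i.e. the Tjurina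
algebra `K[[x]]/tj(f)` is finite-dimensional over `K`. [cite: BoubakriGreuelMarkwig2010, §1 (p. 3)] -/
def IsIsolatedHypersurface (f : MvPowerSeries (Fin n) K) : Prop :=
  Module.Finite K (MvPowerSeries (Fin n) K ⧸ tjurinaIdeal f)

/-- **Right equivalence** `f ∼ᵣ g`: `f = φ(g)` for an automorphism `φ` of `K[[x]]` (the right group
`ℛ = Aut(K[[x]])`, here `K`-algebra automorphisms). [cite: BoubakriGreuelMarkwig2010, §1 (p. 3)] -/
def RightEquivalent (f g : MvPowerSeries (Fin n) K) : Prop :=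
  ∃ φ : MvPowerSeries (Fin n) K ≃ₐ[K] MvPowerSeries (Fin n) K, f = φ g

/-- **Contact equivalence** `f ∼_c g`: `f = u · φ(g)` for an automorphism `φ` of `K[[x]]` and a unit
`u ∈ K[[x]]*` (the contact group `𝒦 = K[[x]]* ⋉ Aut(K[[x]])`; equivalently `R_f ≅ R_g` as local
`K`-algebras). [cite: BoubakriGreuelMarkwig2010, §1 (p. 3)] -/
def ContactEquivalent (f g : MvPowerSeries (Fin n) K) : Prop :=
  ∃ (φ : MvPowerSeries (Fin n) K ≃ₐ[K] MvPowerSeries (Fin n) K) (u : (MvPowerSeries (Fin n) K)ˣ),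
    f = (u : MvPowerSeries (Fin n) K) * φ g

/-- `f` and `g` have **the same `k`-jet**: `jet_k(f) = jet_k(g)` in `K[[x]]/𝔪^{k+1}`, i.e.
`f − g ∈ 𝔪^{k+1}` ("`g` coincides with `f` up to order `k`").
[cite: BoubakriGreuelMarkwig2010, §1 (p. 4)] -/
def HaveSameJet (k : ℕ) (f g : MvPowerSeries (Fin n) K) : Prop :=
  f - g ∈ maximalIdeal (MvPowerSeries (Fin n) K) ^ (k + 1)

/-- `f` is **right `k`-determined**: `f` is right equivalent to every `g ∈ K[[x]]` whose `k`-jet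
coincides with that of `f`. [cite: BoubakriGreuelMarkwig2010, §1 (p. 4)] -/
def IsRightDetermined (k : ℕ) (f : MvPowerSeries (Fin n) K) : Prop :=
  ∀ g : MvPowerSeries (Fin n) K, HaveSameJet k f g → RightEquivalent f g

/-- `f` is **contact `k`-determined**: `f` is contact equivalent to every `g ∈ K[[x]]` whose `k`-jet
coincides with that of `f`. [cite: BoubakriGreuelMarkwig2010, §1 (p. 4)] -/
def IsContactDetermined (k : ℕ) (f : MvPowerSeries (Fin n) K) : Prop :=
  ∀ g : MvPowerSeries (Fin n) K, HaveSameJet k f g → ContactEquivalent f g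

/-- The **order** `ord(f)` of a power series: "the largest integer `k` such that `f ∈ 𝔪ᵏ`, i.e. the
smallest `k` such that `f` has non-zero terms of degree `k`" (`ord(0) = ∞`); rendered as Mathlib's
total-degree order `MvPowerSeries.order f : ℕ∞` truncated to `ℕ` (junk value `0` at `f = 0`, where
the facts below assume `f ≠ 0`). [cite: BoubakriGreuelMarkwig2010, §2 (p. 6)] -/
def ord (f : MvPowerSeries (Fin n) K) : ℕ :=
  (MvPowerSeries.order f).toNat

/-- **Boubakri–Greuel–Markwig, Theorem 2.1 (improved finite determinacy bounds, any
characteristic).** Let `K` be an algebraically closed field (any characteristic), `n ≥ 2`,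
`0 ≠ f ∈ 𝔪² ⊆ K[[x₁,…,xₙ]]` and `k ∈ ℕ`.
(1) If `𝔪^{k+2} ⊆ 𝔪²·j(f)`, then `f` is right `(2k − ord(f) + 2)`-determined.
(2) If `𝔪^{k+2} ⊆ 𝔪·⟨f⟩ + 𝔪²·j(f)`, then `f` is contact `(2k − ord(f) + 2)`-determined.
(Under either hypothesis `ord(f) ≤ k + 1`, first line of the printed proof, so the `ℕ`-subtraction
`2 * k + 2 - ord f` is exact.) Named fact, not proved here; grounds input (i) "finite determinacy" of
`Summit.ResolutionOfSingularities.ResolutionOfSingularities.Theses.FrobeniusClosing.ClosingReduction`.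
[cite: BoubakriGreuelMarkwig2010, Thm. 2.1] -/
def Thm21 : Prop :=
  ∀ (K : Type) [Field K] [IsAlgClosed K] (n : ℕ), 2 ≤ n →
    ∀ (f : MvPowerSeries (Fin n) K) (k : ℕ), f ≠ 0 →
      f ∈ maximalIdeal (MvPowerSeries (Fin n) K) ^ 2 →
        (maximalIdeal (MvPowerSeries (Fin n) K) ^ (k + 2) ≤
            maximalIdeal (MvPowerSeries (Fin n) K) ^ 2 * jacobianIdeal f →
          IsRightDetermined (2 * k + 2 - ord f) f) ∧
        (maximalIdeal (MvPowerSeries (Fin n) K) ^ (k + 2) ≤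
            maximalIdeal (MvPowerSeries (Fin n) K) * Ideal.span {f} +
              maximalIdeal (MvPowerSeries (Fin n) K) ^ 2 * jacobianIdeal f →
          IsContactDetermined (2 * k + 2 - ord f) f)

/-- **Boubakri–Greuel–Markwig, Corollary 2.4 (determinacy bound by the Milnor / Tjurina number).**
Let `K` be an algebraically closed field (any characteristic), `n ≥ 2`, `0 ≠ f ∈ 𝔪² ⊆ K[[x₁,…,xₙ]]`.
(1) If `μ(f) < ∞`, then the right determinacy of `f` is at most `2μ(f) − ord(f) + 2` (i.e. `f` is
right `(2μ(f) − ord(f) + 2)`-determined).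
(2) If `τ(f) < ∞`, then the contact determinacy of `f` is at most `2τ(f) − ord(f) + 2`.
(From Thm. 2.1 with `k = μ(f)` resp. `τ(f)`, since `𝔪^{μ(f)} ⊆ j(f)` and `𝔪^{τ(f)} ⊆ tj(f)`,
Remark 2.3(c); in particular `ord(f) ≤ μ(f) + 1` resp. `≤ τ(f) + 1`, so the `ℕ`-subtraction is
exact.) Named fact, not proved here; with a uniform bound `μ ≤ β` it puts every isolated `f` of a
`μ`-bounded family in ONE finite jet space `K[[x]]/𝔪^{2β+3}` up to right equivalence — the use made
of it by `Summit.ResolutionOfSingularities.ResolutionOfSingularities.Theses.FrobeniusClosing.ClosingReduction`.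
[cite: BoubakriGreuelMarkwig2010, Cor. 2.4] -/
def Cor24 : Prop :=
  ∀ (K : Type) [Field K] [IsAlgClosed K] (n : ℕ), 2 ≤ n →
    ∀ f : MvPowerSeries (Fin n) K, f ≠ 0 → f ∈ maximalIdeal (MvPowerSeries (Fin n) K) ^ 2 →
      (IsIsolated f → IsRightDetermined (2 * milnorNumber f + 2 - ord f) f) ∧
      (IsIsolatedHypersurface f → IsContactDetermined (2 * tjurinaNumber f + 2 - ord f) f)

end BoubakriGreuelMarkwig

end Literature.AlgebraicGeometry.Resolution

end
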